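import Summits.BirchSwinnertonDyer.BirchSwinnertonDyer.Theorems.BiquadraticEisensteinDescentHeegnerTwistCouplingInSupplySymbolicMonskyDesignExists
import HarnessLib

set_option linter.dupNamespace false -- `Summit.BirchSwinnertonDyer.BirchSwinnertonDyer.Theorems.…` (summit = sub)
set_option autoImplicit false

/-!
# Crux `HeegnerTwistCouplingInSupply` (stmt-BirchSwinnertonDyer-21381) — the LAPLACIAN of a `μ = 1` base (exactly one base prime `≡ 3 (mod 4)`):
# symmetry, kernel pairs, and `(ker L)^⊥ ⊆ im L` (tools for THEOREM B, `…SymbolicMonskyMuOneExists`)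

Route `BiquadraticEisensteinDescent` (cell `pub/bsd-wall`, width seat `bsd-wall-cm-bed-w3` g23; `--supports` 21381, helper). For a base datum
`base : SymbData (k+1)` (primes `P₀ … P_k` of the odd congruent number `n₀`; `N(b,b') = [(P_b'/P_b) = −1]`, `m_b = [P_b ≡ 3 (4)]`,
`d_b = [(2/P_b) = −1]`) write `(Lx)_b = Σ_b' N(b,b')(x_b' + x_b)` for the Laplacian of the non-residue graph (the operator of the hypotheses
`hE1`/`hE2` of `…SymbolicMonskyDesign*` and of the reviewed `SymbData.virtualKernel`). When EXACTLY ONE base prime `P_(b₀)` is `≡ 3 (mod 4)`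
(`μ = 1`: hypothesis `hμ : negNegOne (base.cls b) = true ↔ b = b₀`) quadratic reciprocity makes the completed symbol symmetric off the diagonal
(`bz_neg_add_bz_neg_swap`), so `L` is the Laplacian of an UNDIRECTED graph: `Σ_b (Ly)_b = 0` (`sum_lap_eq_zero`), `⟨v, Lx⟩ = ⟨x, Lv⟩`
(`lap_adjoint`), and the virtual kernel pairs `(x, y)` (`(L + D_m)x + D_d y = 0`, `D_m x + L y = 0`) are exactly `x_(b₀) = 0 ∧ Ly = 0 ∧ Lx = D_d y`
(`muOne_kernelPair`, `muOne_kernelPair_of`). Finally `exists_lap_eq_of_orthogonal_ker`: a vector orthogonal to `ker L` is `Lu` for some `u` with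
`u_(b₀) = 0` — the finite-dimensional `(ker L)^⊥ = im Lᵀ = im L` via Mathlib's `LinearMap.range_dualMap_eq_dualAnnihilator_ker` (the Laplacian and
the dot-product forms are packaged as linear maps in EXISTENCE form, `exists_lap_linearMap` / `exists_dot_dual`, so that no definition is introduced).

HONEST FRAMING: linear algebra over `𝔽₂`; RUNG-LEVEL corner layer (congruent `j = 1728` families); the crux (C⁺), its registered stubs and BSD are
untouched; nothing is closed. THEOREMS ONLY. Reference: [HeathBrown1994] D. R. Heath-Brown, Invent. Math. 118 (1994) 331–370, appendix (Monsky),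
typescript pp. 39–41.
-/

namespace Summit.BirchSwinnertonDyer.BirchSwinnertonDyer.Theorems.SymbolicMonsky

section MuOneLaplacian

open Matrix Module

variable {k : ℕ} (base : SymbData (k + 1))

/-- `a + c = 0 → a = c` in `𝔽₂`. -/
private theorem F2_eq_of_add_eq_zero {a c : ZMod 2} (h : a + c = 0) : a = c := by
  revert a c; decide

/-! ### The symbol is symmetric when exactly one base prime is `≡ 3 (mod 4)` -/

/-- With exactly one base prime `≡ 3 (mod 4)` (`μ = 1`), `bz N(b,b') + bz N(b',b) = 0` for ALL `b, b'` (quadratic reciprocity off the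
diagonal, `x + x = 0` on it): the non-residue graph is undirected. [folklore] -/
theorem bz_neg_add_bz_neg_swap (b₀ : Fin (k + 1)) (hμ : ∀ b, negNegOne (base.cls b) = true ↔ b = b₀)
    (b b' : Fin (k + 1)) : bz (base.neg b b') + bz (base.neg b' b) = 0 := by
  by_cases hbb : b = b'
  · subst hbb; exact zmod_two_add_self _
  · have key : base.neg b b' = base.neg b' b := by
      have hnn : (negNegOne (base.cls b) && negNegOne (base.cls b')) = false := by
        rw [Bool.eq_false_iff]
        intro hcon
        rw [Bool.and_eq_true] at hcon
        exact hbb (((hμ b).1 hcon.1).trans ((hμ b').1 hcon.2).symm)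
      have hnn' : (negNegOne (base.cls b') && negNegOne (base.cls b)) = false := by rw [Bool.and_comm]; exact hnn
      unfold SymbData.neg
      rcases lt_or_gt_of_ne hbb with h | h
      · rw [if_pos h, if_neg (not_lt.2 h.le), hnn', Bool.xor_false]
      · rw [if_neg (not_lt.2 h.le), if_pos h, hnn, Bool.xor_false]
    rw [key]; exact zmod_two_add_self _

/-- `μ = 1`: `bz [P_b ≡ 3 (4)] = [b = b₀]`. -/
theorem bz_negNegOne_eq (b₀ : Fin (k + 1)) (hμ : ∀ b, negNegOne (base.cls b) = true ↔ b = b₀) (b : Fin (k + 1)) :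
    bz (negNegOne (base.cls b)) = if b = b₀ then 1 else 0 := by
  by_cases h : b = b₀
  · rw [if_pos h, (hμ b).2 h]; rfl
  · rw [if_neg h]
    cases hnb : negNegOne (base.cls b) with
    | false => rfl
    | true => exact absurd ((hμ b).1 hnb) h

/-! ### The Laplacian `(Lx)_b = Σ_b' N(b,b')(x_b' + x_b)` of the (undirected) non-residue graph -/

/-- The Laplacian is additive. -/
theorem lap_add (x y : Fin (k + 1) → ZMod 2) (b : Fin (k + 1)) :
    (∑ b', bz (base.neg b b') * ((x b' + y b') + (x b + y b))) =
      (∑ b', bz (base.neg b b') * (x b' + x b)) + ∑ b', bz (base.neg b b') * (y b' + y b) := by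
  rw [← Finset.sum_add_distrib]; exact Finset.sum_congr rfl fun b' _ => by ring

/-- The Laplacian of `x + γ u`. -/
theorem lap_add_smul (x u : Fin (k + 1) → ZMod 2) (γ : ZMod 2) (b : Fin (k + 1)) :
    (∑ b', bz (base.neg b b') * ((x b' + γ * u b') + (x b + γ * u b))) =
      (∑ b', bz (base.neg b b') * (x b' + x b)) + γ * ∑ b', bz (base.neg b b') * (u b' + u b) := by
  rw [Finset.mul_sum, ← Finset.sum_add_distrib]; exact Finset.sum_congr rfl fun b' _ => by ring

/-- The Laplacian kills constants: `L(x + c·1) = Lx`. -/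
theorem lap_add_const (x : Fin (k + 1) → ZMod 2) (c : ZMod 2) (b : Fin (k + 1)) :
    (∑ b', bz (base.neg b b') * ((x b' + c) + (x b + c))) = ∑ b', bz (base.neg b b') * (x b' + x b) :=
  Finset.sum_congr rfl fun b' _ => by
    have : (x b' + c) + (x b + c) = x b' + x b := by
      have hc : c + c = 0 := zmod_two_add_self c
      linear_combination hc
    rw [this]

/-- `L 1 = 0` (coordinate form: `Σ_b' N(b,b')(c + c) = 0`). -/
theorem lap_const (c : ZMod 2) (b : Fin (k + 1)) : (∑ b', bz (base.neg b b') * (c + c)) = 0 :=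
  Finset.sum_eq_zero fun b' _ => by rw [zmod_two_add_self, mul_zero]

/-- `μ = 1`: the column sums of the Laplacian vanish, `Σ_b (Ly)_b = 0`. [folklore] -/
theorem sum_lap_eq_zero (b₀ : Fin (k + 1)) (hμ : ∀ b, negNegOne (base.cls b) = true ↔ b = b₀)
    (y : Fin (k + 1) → ZMod 2) : (∑ b, ∑ b', bz (base.neg b b') * (y b' + y b)) = 0 := by
  have h1 : (∑ b, ∑ b', bz (base.neg b b') * (y b' + y b)) =
      (∑ b, ∑ b', bz (base.neg b b') * y b') + ∑ b, ∑ b', bz (base.neg b b') * y b := by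
    rw [← Finset.sum_add_distrib]; refine Finset.sum_congr rfl fun b _ => ?_
    rw [← Finset.sum_add_distrib]; exact Finset.sum_congr rfl fun b' _ => by ring
  have h2 : (∑ b, ∑ b', bz (base.neg b b') * y b') = ∑ b, ∑ b', bz (base.neg b' b) * y b := by
    rw [Finset.sum_comm]
  rw [h1, h2, ← Finset.sum_add_distrib]
  refine Finset.sum_eq_zero fun b _ => ?_
  rw [← Finset.sum_add_distrib]
  refine Finset.sum_eq_zero fun b' _ => ?_
  have := bz_neg_add_bz_neg_swap base b₀ hμ b' b
  calc bz (base.neg b' b) * y b + bz (base.neg b b') * y b = (bz (base.neg b' b) + bz (base.neg b b')) * y b := by ring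
    _ = 0 := by rw [this, zero_mul]

/-- `μ = 1`: the Laplacian is self-adjoint for the dot product, `⟨v, Lx⟩ = ⟨x, Lv⟩`. [folklore] -/
theorem lap_adjoint (b₀ : Fin (k + 1)) (hμ : ∀ b, negNegOne (base.cls b) = true ↔ b = b₀)
    (x v : Fin (k + 1) → ZMod 2) :
    (∑ b, v b * ∑ b', bz (base.neg b b') * (x b' + x b)) = ∑ b, x b * ∑ b', bz (base.neg b b') * (v b' + v b) := by
  have e1 : (∑ b, v b * ∑ b', bz (base.neg b b') * (x b' + x b)) =
      (∑ b, ∑ b', bz (base.neg b b') * (v b * x b')) + ∑ b, ∑ b', bz (base.neg b b') * (v b * x b) := by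
    rw [← Finset.sum_add_distrib]; refine Finset.sum_congr rfl fun b _ => ?_
    rw [Finset.mul_sum, ← Finset.sum_add_distrib]; exact Finset.sum_congr rfl fun b' _ => by ring
  have e2 : (∑ b, x b * ∑ b', bz (base.neg b b') * (v b' + v b)) =
      (∑ b, ∑ b', bz (base.neg b b') * (x b * v b')) + ∑ b, ∑ b', bz (base.neg b b') * (v b * x b) := by
    rw [← Finset.sum_add_distrib]; refine Finset.sum_congr rfl fun b _ => ?_
    rw [Finset.mul_sum, ← Finset.sum_add_distrib]; exact Finset.sum_congr rfl fun b' _ => by ring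
  rw [e1, e2, add_left_inj, Finset.sum_comm]
  refine Finset.sum_congr rfl fun b _ => Finset.sum_congr rfl fun b' _ => ?_
  have hn : bz (base.neg b' b) = bz (base.neg b b') := F2_eq_of_add_eq_zero (bz_neg_add_bz_neg_swap base b₀ hμ b' b)
  rw [hn]; ring

/-- `μ = 1`: `⟨v, Lx⟩ = 0` for `v` in the kernel of the Laplacian. -/
theorem sum_mul_lap_eq_zero_of_ker (b₀ : Fin (k + 1)) (hμ : ∀ b, negNegOne (base.cls b) = true ↔ b = b₀)
    (x v : Fin (k + 1) → ZMod 2) (hv : ∀ b, (∑ b', bz (base.neg b b') * (v b' + v b)) = 0) :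
    (∑ b, v b * ∑ b', bz (base.neg b b') * (x b' + x b)) = 0 := by
  rw [lap_adjoint base b₀ hμ]; exact Finset.sum_eq_zero fun b _ => by rw [hv b, mul_zero]

/-! ### Kernel pairs of a `μ = 1` base -/

/-- `μ = 1`: a virtual kernel pair `(x, y)` has `x_(b₀) = 0`, `Ly = 0` and `Lx = D_d y`. [folklore] -/
theorem muOne_kernelPair (b₀ : Fin (k + 1)) (hμ : ∀ b, negNegOne (base.cls b) = true ↔ b = b₀)
    {x y : Fin (k + 1) → ZMod 2}
    (hx : ∀ i, (∑ j, bz (base.neg i j) * (x j + x i)) + bz (negNegOne (base.cls i)) * x i + bz (negTwo (base.cls i)) * y i = 0)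
    (hy : ∀ i, bz (negNegOne (base.cls i)) * x i + ∑ j, bz (base.neg i j) * (y j + y i) = 0) :
    x b₀ = 0 ∧ (∀ i, (∑ j, bz (base.neg i j) * (y j + y i)) = 0) ∧
      (∀ i, (∑ j, bz (base.neg i j) * (x j + x i)) = bz (negTwo (base.cls i)) * y i) := by
  have hm := bz_negNegOne_eq base b₀ hμ
  have hx0 : x b₀ = 0 := by
    have hsum : (∑ i, (bz (negNegOne (base.cls i)) * x i + ∑ j, bz (base.neg i j) * (y j + y i))) = 0 :=
      Finset.sum_eq_zero fun i _ => hy i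
    rw [Finset.sum_add_distrib, sum_lap_eq_zero base b₀ hμ y, add_zero] at hsum
    simp only [hm, ite_mul, one_mul, zero_mul, Finset.sum_ite_eq', Finset.mem_univ, if_true] at hsum
    exact hsum
  have hmx : ∀ i, bz (negNegOne (base.cls i)) * x i = 0 := fun i => by
    rw [hm]; split_ifs with h
    · rw [h, hx0, mul_zero]
    · exact zero_mul _
  refine ⟨hx0, fun i => ?_, fun i => ?_⟩
  · have := hy i; rwa [hmx i, zero_add] at this
  · have := hx i; rw [hmx i, add_zero] at this; exact F2_eq_of_add_eq_zero this

/-- `μ = 1`: conversely, `x_(b₀) = 0`, `Ly = 0`, `Lx = D_d y` give a virtual kernel pair. [folklore] -/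
theorem muOne_kernelPair_of (b₀ : Fin (k + 1)) (hμ : ∀ b, negNegOne (base.cls b) = true ↔ b = b₀)
    {x y : Fin (k + 1) → ZMod 2} (hx0 : x b₀ = 0) (hLy : ∀ i, (∑ j, bz (base.neg i j) * (y j + y i)) = 0)
    (hLx : ∀ i, (∑ j, bz (base.neg i j) * (x j + x i)) = bz (negTwo (base.cls i)) * y i) :
    (∀ i, (∑ j, bz (base.neg i j) * (x j + x i)) + bz (negNegOne (base.cls i)) * x i + bz (negTwo (base.cls i)) * y i = 0) ∧
      (∀ i, bz (negNegOne (base.cls i)) * x i + ∑ j, bz (base.neg i j) * (y j + y i) = 0) := by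
  have hm := bz_negNegOne_eq base b₀ hμ
  have hmx : ∀ i, bz (negNegOne (base.cls i)) * x i = 0 := fun i => by
    rw [hm]; split_ifs with h
    · rw [h, hx0, mul_zero]
    · exact zero_mul _
  refine ⟨fun i => ?_, fun i => ?_⟩
  · rw [hLx i, hmx i, add_zero]; exact zmod_two_add_self _
  · rw [hmx i, hLy i, add_zero]

/-! ### The Laplacian as a linear map; its image is the orthogonal of its kernel -/

/-- The Laplacian as a linear map (existence form, so that no definition is introduced). -/
theorem exists_lap_linearMap : ∃ L : (Fin (k + 1) → ZMod 2) →ₗ[ZMod 2] (Fin (k + 1) → ZMod 2),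
    ∀ x b, L x b = ∑ b', bz (base.neg b b') * (x b' + x b) :=
  ⟨{ toFun := fun x b => ∑ b', bz (base.neg b b') * (x b' + x b)
     map_add' := fun x y => by
       funext b
       simp only [Pi.add_apply]
       rw [← Finset.sum_add_distrib]
       exact Finset.sum_congr rfl fun b' _ => by ring
     map_smul' := fun a x => by
       funext b
       simp only [Pi.smul_apply, smul_eq_mul, RingHom.id_apply]
       rw [Finset.mul_sum]
       exact Finset.sum_congr rfl fun b' _ => by ring }, fun _ _ => rfl⟩

/-- The dot product with a fixed vector as a linear form (existence form). -/
theorem exists_dot_dual (c : Fin (k + 1) → ZMod 2) : ∃ φ : Dual (ZMod 2) (Fin (k + 1) → ZMod 2), ∀ x, φ x = ∑ b, c b * x b :=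
  ⟨{ toFun := fun x => ∑ b, c b * x b
     map_add' := fun x y => by
       simp only [Pi.add_apply]; rw [← Finset.sum_add_distrib]
       exact Finset.sum_congr rfl fun b _ => by ring
     map_smul' := fun a x => by
       simp only [Pi.smul_apply, smul_eq_mul, RingHom.id_apply]; rw [Finset.mul_sum]
       exact Finset.sum_congr rfl fun b _ => by ring }, fun _ => rfl⟩

/-- `μ = 1`: a vector orthogonal to the kernel of the (self-adjoint) Laplacian is in its image, `(ker L)^⊥ ⊆ im L`; the preimage may be
taken with `b₀`-coordinate `0` (add `1 ∈ ker L`). [folklore] -/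
theorem exists_lap_eq_of_orthogonal_ker (b₀ : Fin (k + 1)) (hμ : ∀ b, negNegOne (base.cls b) = true ↔ b = b₀)
    (c : Fin (k + 1) → ZMod 2)
    (hc : ∀ v : Fin (k + 1) → ZMod 2, (∀ b, (∑ b', bz (base.neg b b') * (v b' + v b)) = 0) → (∑ b, c b * v b) = 0) :
    ∃ u : Fin (k + 1) → ZMod 2, u b₀ = 0 ∧ ∀ b, (∑ b', bz (base.neg b b') * (u b' + u b)) = c b := by
  classical
  obtain ⟨L, hL⟩ := exists_lap_linearMap base
  obtain ⟨φ, hφ'⟩ := exists_dot_dual c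
  have hφ : φ ∈ (LinearMap.ker L).dualAnnihilator := by
    rw [Submodule.mem_dualAnnihilator]
    intro w hw
    rw [hφ']
    exact hc w fun b => by rw [← hL]; exact congrFun (LinearMap.mem_ker.1 hw) b
  rw [← LinearMap.range_dualMap_eq_dualAnnihilator_ker, LinearMap.mem_range] at hφ
  obtain ⟨ψ, hψ⟩ := hφ
  set u₀ : Fin (k + 1) → ZMod 2 := fun b => ψ (fun j => if b = j then 1 else 0) with hu₀
  have hLu₀ : ∀ b, (∑ b', bz (base.neg b b') * (u₀ b' + u₀ b)) = c b := by
    intro b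
    have h1 : c b = φ (fun j => if b = j then 1 else 0) := by
      rw [hφ']
      simp only [mul_ite, mul_one, mul_zero, Finset.sum_ite_eq, Finset.mem_univ, if_true]
    have h2 : φ (fun j => if b = j then 1 else 0) = ψ (L (fun j => if b = j then 1 else 0)) := by
      rw [← hψ, LinearMap.dualMap_apply]
    have h3 : ψ (L (fun j => if b = j then 1 else 0)) = ∑ b', u₀ b' * L (fun j => if b = j then 1 else 0) b' :=
      dual_apply_eq_sum ψ _
    have h4 := lap_adjoint base b₀ hμ (fun j => if b = j then (1 : ZMod 2) else 0) u₀
    simp only [hL] at h3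
    rw [h1, h2, h3, h4]
    simp only [ite_mul, one_mul, zero_mul, Finset.sum_ite_eq, Finset.mem_univ, if_true]
  refine ⟨fun b => u₀ b + u₀ b₀, by exact zmod_two_add_self _, fun b => ?_⟩
  rw [lap_add_const base u₀ (u₀ b₀) b]
  exact hLu₀ b

end MuOneLaplacian

end Summit.BirchSwinnertonDyer.BirchSwinnertonDyer.Theorems.SymbolicMonsky
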